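import Literature.AnabelianGeometry.SemiGraphs.QuotientApproximator
import Literature.AnabelianGeometry.Anabelioids.AutOfEquivalence

/-!
# Branch subgroups of the quotient approximator ([SemiAnbd] Def. 2.3 / Def. 2.4 (i), Ex. 2.10)

Sequel to `QuotientApproximator.lean` (cell abc-iut, layer L3, row G31 (2), seat abc-iut-L3-t4):
the same quotient approximator `φ : 𝒢 → 𝒢'` (`𝒢'_v = B(Π_v/W_v)`, `𝒢'_e = B(Π_e/N_e)` for compatible
open normal data) together with the description of ITS BRANCH SUBGROUPS at ARBITRARY basepoints,
which [SemiAnbd] Def. 2.4 (i) ("elevated": a subgroup of `π₁(𝒢'_v)` having trivial intersection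
with all conjugates of all the `Π'_b`, for every basepoint and every representative) quantifies over
[cite: MochizukiSemiAnbd2006, Def. 2.4(i) p.25]: for every basepoint `F'` of `𝒢'_v` there is a
continuous surjection `θ : Π_v = Aut Fv ↠ Aut F'` with kernel `W_v` (change of basepoint composed
with `π₁` of the quotient morphism) such that every branch subgroup `Π'_b ⊆ Aut F'` (any basepoint of
`𝒢'_e`, any representative) is a conjugate of the image `θ(Π_b)` of a branch subgroup of `𝒢`
(`exists_quotientApproximator_branches`).  Proof: `π₁` of the restricted `b_*` is computed on the
standard basepoints through the surjection `Π_e ↠ π₁(𝒢'_e)` and the change-of-basepoint formula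
`π₁(P)(e-conjugate) = (P ⋆ e)-conjugate ∘ π₁(P)`; two isomorphisms of basepoints differ by an
automorphism, i.e. an inner automorphism of `Aut F'`.  Nothing here takes a side on any disputed claim.
-/

namespace Literature.AnabelianGeometry.SemiGraphs

open CategoryTheory CategoryTheory.Limits CategoryTheory.PreGaloisCategory
open Literature.AnabelianGeometry.Anabelioids
open scoped Pointwise

universe v₁ u₁ u

/-- A finite-limit-preserving functor lifted to a full subcategory still preserves finite limits.
[folklore] -/
private theorem preservesFiniteLimits_lift'' {C : Type*} [Category C] {D : Type*} [Category D]
    (P : ObjectProperty D) (F : C ⥤ D) (hF : ∀ A, P (F.obj A)) [PreservesFiniteLimits F] :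
    PreservesFiniteLimits (P.lift F hF) := by
  refine ⟨fun J _ _ => ?_⟩
  haveI : PreservesLimitsOfShape J (P.lift F hF ⋙ P.ι) :=
    preservesLimitsOfShape_of_natIso (P.liftCompιIso F hF).symm
  exact preservesLimitsOfShape_of_reflects_of_preserves (P.lift F hF) P.ι

/-- A finite-colimit-preserving functor lifted to a full subcategory still preserves finite
colimits. [folklore] -/
private theorem preservesFiniteColimits_lift'' {C : Type*} [Category C] {D : Type*} [Category D]
    (P : ObjectProperty D) (F : C ⥤ D) (hF : ∀ A, P (F.obj A)) [PreservesFiniteColimits F] :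
    PreservesFiniteColimits (P.lift F hF) := by
  refine ⟨fun J _ _ => ?_⟩
  haveI : PreservesColimitsOfShape J (P.lift F hF ⋙ P.ι) :=
    preservesColimitsOfShape_of_natIso (P.liftCompιIso F hF).symm
  exact preservesColimitsOfShape_of_reflects_of_preserves (P.lift F hF) P.ι

/-- Conjugation by an isomorphism of fibre functors is continuous. [folklore] -/
private theorem continuous_conjAut_of_iso'' {C : Type*} [Category C] [GaloisCategory C]
    {F F' : C ⥤ FintypeCat.{v₁}} [FiberFunctor F] [FiberFunctor F'] (e : F ≅ F') :
    Continuous e.conjAut := by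
  rw [(autEmbedding_isClosedEmbedding F').isInducing.continuous_iff, continuous_pi_iff]
  intro X
  have hco : (fun σ : Aut F => autEmbedding F' (e.conjAut σ) X) =
      fun σ => (e.app X).conjAut (autEmbedding F σ X) := by
    funext σ
    refine Iso.ext ?_
    simp [Iso.conj_apply, autEmbedding_apply]
  rw [show (autEmbedding F' ∘ e.conjAut) = fun σ => autEmbedding F' (e.conjAut σ) from rfl]
  change Continuous fun σ : Aut F => autEmbedding F' (e.conjAut σ) X
  rw [hco]
  exact continuous_of_discreteTopology.comp
    ((continuous_apply X).comp (autEmbedding_isClosedEmbedding F).continuous)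

/-- `Aut.autMulEquivOfIso` is `Iso.conjAut`. [folklore] -/
private theorem autMulEquivOfIso_eq_conjAut'' {C : Type*} [Category C] {F G : C ⥤ FintypeCat.{v₁}}
    (h : F ≅ G) (x : Aut F) : Aut.autMulEquivOfIso h x = h.conjAut x :=
  Iso.ext (by rw [Iso.conjAut_hom, Iso.conj_apply]; rfl)

/-- Conjugation by an AUTOmorphism of a basepoint is the inner automorphism it defines. [folklore] -/
private theorem conjAut_self_eq_conj {C : Type*} [Category C] {F : C ⥤ FintypeCat.{v₁}}
    (δ : Aut F) (x : Aut F) : Iso.conjAut δ x = ConjAct.toConjAct δ • x := by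
  rw [Iso.conjAut_apply, ConjAct.smul_def, ConjAct.ofConjAct_toConjAct, Aut.Aut_mul_def,
    Aut.Aut_mul_def, Aut.Aut_inv_def]

namespace SemiGraphOfAnabelioids

variable (𝒢 : SemiGraphOfAnabelioids.{v₁, u₁, u})

/-- **The quotient approximator with its branch subgroups.** Same data and conclusion as
`exists_quotientApproximator_of_compat`, plus: for every vertex `v` and EVERY basepoint `F'` of
`𝒢'_v` there is a continuous surjection `θ : Π_v ↠ Aut F'` with kernel `W_v` such that for every
branch `b` of `𝒢'` abutting to `v` (the underlying semi-graph of `𝒢'` is that of `𝒢`), every basepoint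
of `𝒢'_e` and every representative `Π'_b`, `Π'_b` is a conjugate of `θ(Π_b)` for the branch subgroup
`Π_b ⊆ Π_v` of `𝒢` at ANY representative. [cite: MochizukiSemiAnbd2006, Def. 2.4(i) p.25] -/
theorem exists_quotientApproximator_branches
    (Fv : ∀ v : 𝒢.graph.Vertex, 𝒢.V v ⥤ FintypeCat.{v₁}) [∀ v, FiberFunctor (Fv v)]
    (W : ∀ v, Subgroup (Aut (Fv v))) (hWo : ∀ v, IsOpen (W v : Set (Aut (Fv v))))
    (hWn : ∀ v, (W v).Normal)
    (Fe : ∀ e : 𝒢.graph.Edge, 𝒢.E e ⥤ FintypeCat.{v₁}) [∀ e, FiberFunctor (Fe e)]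
    (N : ∀ e, Subgroup (Aut (Fe e))) (hNo : ∀ e, IsOpen (N e : Set (Aut (Fe e))))
    (hNn : ∀ e, (N e).Normal)
    (hcompat : ∀ (b : 𝒢.graph.Branch) (v : 𝒢.graph.Vertex) (h : 𝒢.graph.abuts b = some v),
      ∃ α : (𝒢.pull b v h).pullback ⋙ Fe (𝒢.graph.edgeOf b) ≅ Fv v,
        N (𝒢.graph.edgeOf b) = (W v).comap ((Aut.autMulEquivOfIso α).toMonoidHom.comp
          (pi1Map (𝒢.pull b v h).pullback (Fe (𝒢.graph.edgeOf b)))))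
    (M : ℕ) (hM : 1 ≤ M) (hdvd : ∀ v, (W v).index ∣ M) :
    ∃ (𝒢' : SemiGraphOfAnabelioids.{v₁, u₁, u}) (φ : Hom 𝒢 𝒢'),
      φ.IsPi1EpiApproximator ∧
      (∀ v, (pi1Map (φ.φV v).pullback (Fv v)).ker = W v) ∧
      (∀ e, (pi1Map (φ.φE e (φ.base.edgeMap e) rfl).pullback (Fe e)).ker = N e) ∧
      (∀ (v : 𝒢.graph.Vertex) (F : 𝒢'.V (φ.base.vertexMap v) ⥤ FintypeCat.{v₁}) [FiberFunctor F],
        Finite (Aut F) ∧ Nat.card (Aut F) = (W v).index) ∧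
      ∀ (v : 𝒢.graph.Vertex) (F' : 𝒢'.V (φ.base.vertexMap v) ⥤ FintypeCat.{v₁}) [FiberFunctor F'],
        ∃ θ : Aut (Fv v) →* Aut F', Continuous θ ∧ Function.Surjective θ ∧ θ.ker = W v ∧
          ∀ (b : 𝒢'.graph.Branch) (h : 𝒢'.graph.abuts b = some (φ.base.vertexMap v))
            (Fe' : 𝒢'.E (𝒢'.graph.edgeOf b) ⥤ FintypeCat.{v₁}) [FiberFunctor Fe']
            (α' : (𝒢'.pull b _ h).pullback ⋙ Fe' ≅ F'),
            ∃ (b₀ : 𝒢.graph.Branch) (h₀ : 𝒢.graph.abuts b₀ = some v),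
              ∀ α₀ : (𝒢.pull b₀ v h₀).pullback ⋙ Fe (𝒢.graph.edgeOf b₀) ≅ Fv v, ∃ g₀ : Aut F',
                𝒢'.branchSubgroup F' b h Fe' α' =
                  ConjAct.toConjAct g₀ • (𝒢.branchSubgroup (Fv v) b₀ h₀ (Fe _) α₀).map θ := by
  haveI := hWn
  haveI := hNn
  -- the restricted `b^*` land in the edge quotients
  have hmem : ∀ (b : 𝒢.graph.Branch) (v : 𝒢.graph.Vertex) (h : 𝒢.graph.abuts b = some v)
      (A : Fixed (Fv v) (W v)),
      fixedObj (Fe (𝒢.graph.edgeOf b)) (N (𝒢.graph.edgeOf b))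
        ((𝒢.pull b v h).pullback.obj A.obj) := by
    intro b v h A
    obtain ⟨α, hN⟩ := hcompat b v h
    exact fixedObj_pull_obj_of_compat _ _ _ α _ _ hN.le A.property
  have hexL : ∀ (b : 𝒢.graph.Branch) (v : 𝒢.graph.Vertex) (h : 𝒢.graph.abuts b = some v),
      PreservesFiniteLimits ((fixedObj (Fe (𝒢.graph.edgeOf b)) (N (𝒢.graph.edgeOf b))).lift
        ((fixedObj (Fv v) (W v)).ι ⋙ (𝒢.pull b v h).pullback) (hmem b v h)) := by
    intro b v h
    haveI : PreservesFiniteLimits ((fixedObj (Fv v) (W v)).ι ⋙ (𝒢.pull b v h).pullback) :=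
      comp_preservesFiniteLimits _ _
    exact preservesFiniteLimits_lift'' _ _ _
  have hexC : ∀ (b : 𝒢.graph.Branch) (v : 𝒢.graph.Vertex) (h : 𝒢.graph.abuts b = some v),
      PreservesFiniteColimits ((fixedObj (Fe (𝒢.graph.edgeOf b)) (N (𝒢.graph.edgeOf b))).lift
        ((fixedObj (Fv v) (W v)).ι ⋙ (𝒢.pull b v h).pullback) (hmem b v h)) := by
    intro b v h
    haveI : PreservesFiniteColimits ((fixedObj (Fv v) (W v)).ι ⋙ (𝒢.pull b v h).pullback) :=
      comp_preservesFiniteColimits _ _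
    exact preservesFiniteColimits_lift'' _ _ _
  let 𝒢' : SemiGraphOfAnabelioids.{v₁, u₁, u} :=
    { graph := 𝒢.graph
      V := fun v => Fixed (Fv v) (W v)
      E := fun e => Fixed (Fe e) (N e)
      pull := fun b v h => by
        haveI := hexL b v h
        haveI := hexC b v h
        exact ExactFunctor.of ((fixedObj (Fe (𝒢.graph.edgeOf b)) (N (𝒢.graph.edgeOf b))).lift
          ((fixedObj (Fv v) (W v)).ι ⋙ (𝒢.pull b v h).pullback) (hmem b v h)) }
  let φ : Hom 𝒢 𝒢' :=
    { base := 𝟙 𝒢.graph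
      φV := fun v => Hom.toFixed (Fv v) (W v)
      φE := fun e f hf => by
        subst hf
        exact Hom.toFixed (Fe e) (N e)
      φB := fun _ _ _ => Iso.refl _ }
  have hcard : ∀ (v : 𝒢.graph.Vertex) (F : 𝒢'.V v ⥤ FintypeCat.{v₁}) [FiberFunctor F],
      Finite (Aut F) ∧ Nat.card (Aut F) = (W v).index := fun v F _ =>
    finite_aut_fixed_and_card (Fv v) (W v) (hWo v) F
  -- injective type: `Π'_e = Π_e/N_e → Π'_v = Π_v/W_v` is injective by compatibility
  have hinj : ∀ (b : 𝒢.graph.Branch) (v : 𝒢.graph.Vertex) (h : 𝒢.graph.abuts b = some v),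
      Function.Injective (pi1Map (𝒢'.pull b v h).pullback
        ((fixedObj (Fe (𝒢.graph.edgeOf b)) (N (𝒢.graph.edgeOf b))).ι ⋙ Fe (𝒢.graph.edgeOf b))) := by
    intro b v h
    refine (injective_iff_map_eq_one _).2 fun τ' hτ' => ?_
    obtain ⟨τ, rfl⟩ := pi1Map_fixedι_surjective (Fe _) (N _) (hNo _) τ'
    obtain ⟨α, hN⟩ := hcompat b v h
    -- `π₁(b'^*) ∘ π₁(ι_e) = π₁(ι_e ∘ b'^*) = π₁(b^* ∘ ι_v) = π₁(ι_v) ∘ π₁(b^*)` (definitionally)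
    have h2 : pi1Map (fixedObj (Fv v) (W v)).ι ((𝒢.pull b v h).pullback ⋙ Fe (𝒢.graph.edgeOf b))
        (pi1Map (𝒢.pull b v h).pullback (Fe (𝒢.graph.edgeOf b)) τ) = 1 := hτ'
    have h3 : pi1Map (fixedObj (Fv v) (W v)).ι (Fv v)
        (α.conjAut (pi1Map (𝒢.pull b v h).pullback (Fe (𝒢.graph.edgeOf b)) τ)) = 1 := by
      rw [pi1Map_conjAut, h2, map_one]
    have h4 : Aut.autMulEquivOfIso α (pi1Map (𝒢.pull b v h).pullback (Fe _) τ) ∈ W v := by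
      rw [← ker_pi1Map_fixedι (Fv v) (W v) (hWo v), MonoidHom.mem_ker, autMulEquivOfIso_eq_conjAut'']
      exact h3
    have h5 : τ ∈ N (𝒢.graph.edgeOf b) := by
      rw [hN, Subgroup.mem_comap]
      exact h4
    rw [← MonoidHom.mem_ker, ker_pi1Map_fixedι (Fe _) (N _) (hNo _)]
    exact h5
  refine ⟨𝒢', φ, ⟨⟨?_, ⟨fun b v h => ?_⟩, M, hM, fun v F _ => ?_⟩, fun v => ?_, fun e => ?_⟩,
    fun v => ker_pi1Map_fixedι (Fv v) (W v) (hWo v),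
    fun e => ker_pi1Map_fixedι (Fe e) (N e) (hNo e), hcard, fun v F' hF' => ?_⟩
  · show IsIso (𝟙 𝒢.graph)
    infer_instance
  · exact (isPi1Mono_iff_injective _ _).2 (hinj b v h)
  · exact ⟨(hcard v F).1, (hcard v F).2 ▸ hdvd v⟩
  · exact isPi1Epi_fixedι (Fv v) (W v) (hWo v)
  · exact isPi1Epi_fixedι (Fe e) (N e) (hNo e)
  · -- the branch subgroups at an arbitrary basepoint `F'` of `𝒢'_v = B(Π_v/W_v)`
    let F₀ : 𝒢'.V (φ.base.vertexMap v) ⥤ FintypeCat.{v₁} := (fixedObj (Fv v) (W v)).ι ⋙ Fv v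
    haveI : FiberFunctor F₀ := fiberFunctor_fixedι_comp (Fv v) (W v) (Fv v)
    obtain ⟨eV⟩ := nonempty_iso_of_fiberFunctor F₀ F'
    let θ₀ : Aut (Fv v) →* Aut F₀ := pi1Map (fixedObj (Fv v) (W v)).ι (Fv v)
    let θ : Aut (Fv v) →* Aut F' := eV.conjAut.toMonoidHom.comp θ₀
    have hθ0s : Function.Surjective θ₀ := pi1Map_fixedι_surjective (Fv v) (W v) (hWo v)
    refine ⟨θ, (continuous_conjAut_of_iso'' eV).comp (continuous_pi1Map' _ _),
      eV.conjAut.surjective.comp hθ0s, ?_, fun b h Fe' _ α' => ?_⟩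
    · ext x
      rw [MonoidHom.mem_ker, ← ker_pi1Map_fixedι (Fv v) (W v) (hWo v), MonoidHom.mem_ker]
      change eV.conjAut (θ₀ x) = 1 ↔ θ₀ x = 1
      exact eV.conjAut.map_eq_one_iff
    · -- `b` is a branch of `𝔾` abutting to `v`; the standard basepoint of `𝒢'_e` and its representative
      refine ⟨b, h, fun α₀ => ?_⟩
      let e := 𝒢.graph.edgeOf b
      let Fe₀ : 𝒢'.E (𝒢'.graph.edgeOf b) ⥤ FintypeCat.{v₁} := (fixedObj (Fe e) (N e)).ι ⋙ Fe e
      haveI : FiberFunctor Fe₀ := fiberFunctor_fixedι_comp (Fe e) (N e) (Fe e)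
      obtain ⟨eE⟩ := nonempty_iso_of_fiberFunctor Fe₀ Fe'
      -- the standard representative over the standard basepoints
      let α₀W : (𝒢'.pull b (φ.base.vertexMap v) h).pullback ⋙ Fe₀ ≅ F₀ :=
        Functor.isoWhiskerLeft (fixedObj (Fv v) (W v)).ι α₀
      -- `ψ'₀ ∘ π₁(ι_e) = θ₀ ∘ ψ`
      let ψ : Aut (Fe e) →* Aut (Fv v) :=
        (Aut.autMulEquivOfIso α₀).toMonoidHom.comp (pi1Map (𝒢.pull b v h).pullback (Fe e))
      have hnat : ∀ τ : Aut (Fe e),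
          α₀W.conjAut (pi1Map (𝒢'.pull b (φ.base.vertexMap v) h).pullback Fe₀
            (pi1Map (fixedObj (Fe e) (N e)).ι (Fe e) τ)) = θ₀ (ψ τ) := by
        intro τ
        have h1 : pi1Map (𝒢'.pull b (φ.base.vertexMap v) h).pullback Fe₀
            (pi1Map (fixedObj (Fe e) (N e)).ι (Fe e) τ) =
            pi1Map (fixedObj (Fv v) (W v)).ι ((𝒢.pull b v h).pullback ⋙ Fe e)
              (pi1Map (𝒢.pull b v h).pullback (Fe e) τ) := rfl
        rw [h1]
        change α₀W.conjAut _ = pi1Map (fixedObj (Fv v) (W v)).ι (Fv v)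
          (Aut.autMulEquivOfIso α₀ (pi1Map (𝒢.pull b v h).pullback (Fe e) τ))
        rw [autMulEquivOfIso_eq_conjAut'', pi1Map_conjAut]
        rfl
      -- comparison of the two isomorphisms `(𝒢'.pull)^* ⋙ Fe₀ ≅ F'`
      let β : (𝒢'.pull b (φ.base.vertexMap v) h).pullback ⋙ Fe₀ ≅ F' :=
        Functor.isoWhiskerLeft (𝒢'.pull b (φ.base.vertexMap v) h).pullback eE ≪≫ α'
      let γ : (𝒢'.pull b (φ.base.vertexMap v) h).pullback ⋙ Fe₀ ≅ F' := α₀W ≪≫ eV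
      let δ : Aut F' := γ.symm ≪≫ β
      have hβ : Functor.isoWhiskerLeft (𝒢'.pull b (φ.base.vertexMap v) h).pullback eE ≪≫ α' =
          (α₀W ≪≫ eV) ≪≫ δ := by
        change β = γ ≪≫ (γ.symm ≪≫ β)
        rw [Iso.self_symm_id_assoc]
      clear_value δ
      -- the key identity: `α'_* (π₁(b'^*) (eE_* (π₁(ι_e) τ))) = δ ∘ θ(ψ τ) ∘ δ⁻¹`
      have hkey : ∀ τ : Aut (Fe e),
          Aut.autMulEquivOfIso α' (pi1Map (𝒢'.pull b (φ.base.vertexMap v) h).pullback Fe'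
            (eE.conjAut (pi1Map (fixedObj (Fe e) (N e)).ι (Fe e) τ))) =
            ConjAct.toConjAct δ • θ (ψ τ) := by
        intro τ
        rw [pi1Map_conjAut, autMulEquivOfIso_eq_conjAut'', ← Iso.trans_conjAut, hβ,
          Iso.trans_conjAut, Iso.trans_conjAut, hnat τ]
        exact conjAut_self_eq_conj δ (θ (ψ τ))
      refine ⟨δ, ?_⟩
      -- compute the branch subgroup at `(F', Fe', α')`
      ext x
      constructor
      · rintro ⟨τ', rfl⟩
        obtain ⟨τ₀, rfl⟩ := eE.conjAut.surjective τ'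
        obtain ⟨τ, rfl⟩ := pi1Map_fixedι_surjective (Fe e) (N e) (hNo e) τ₀
        exact (Subgroup.mem_smul_pointwise_iff_exists _ _ _).2
          ⟨θ (ψ τ), ⟨ψ τ, ⟨τ, rfl⟩, rfl⟩, (hkey τ).symm⟩
      · intro hx
        obtain ⟨_, ⟨_, ⟨τ, rfl⟩, rfl⟩, rfl⟩ := (Subgroup.mem_smul_pointwise_iff_exists _ _ _).1 hx
        exact ⟨eE.conjAut (pi1Map (fixedObj (Fe e) (N e)).ι (Fe e) τ), hkey τ⟩

end SemiGraphOfAnabelioids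

end Literature.AnabelianGeometry.SemiGraphs
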